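import Summits.CriticalPhenomena.SAWScalingLimit.Theses.SAWChargeContinuation
import Summits.CriticalPhenomena.SAWScalingLimit.Theorems.SimpleSubseqLimits.Negative.SimpleSubseqLimitsCore
import Literature.Probability.RandomPlanarGeometry.SimpleCurves

/-!
# Line `birth` — registered skeleton for the crux `SubseqSimple` (stmt-CriticalPhenomena-11194)

Crux (FIXED; rank 5 of `route-CriticalPhenomena-SAWChargeContinuation`, decl
`Summit.CriticalPhenomena.SAWScalingLimit.Theses.SAWChargeContinuation.SubseqSimple`): along every
sequence of meshes `s n → 0⁺`, every weak (probability) limit `μ` of the critical `δℤ²` SAW laws in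
`(D_δ; a_δ, b_δ)` — for every Dobrushin domain `D` and EVERY endpoint approximation `(a, b)` — is
carried by the chordal carrier of `D`:

  `μ-a.e. γ ∈ CurveClass.simple ∩ {source = D.pt 0} ∩ {target = D.pt 1} ∩ {range ⊆ D ∪ {D.pt 0, D.pt 1}}`.

Near-twins (same content, other decl texts): `SimpleSubseqLimits` of SAWLoopFugacityFlow / SAWSteinDefect /
SAWTensorRG / SAWFrontierHomotopy (stmt-4982) and of SAWStressTensor & co. (stmt-4514),
`SAWBrownianDomination.SubseqSimple`. The standing disprover of stmt-4982 LANDED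
(`Theorems/SimpleSubseqLimits/Negative/*`, accepted) that the clauses `source = a`, `target = b`,
`range ⊆ closure D` are FREE for every subsequential limit (`ae_source_target_range_of_weakLimitAlong`:
continuity of the endpoints, confinement of lattice polylines to `Ω̄`, portmanteau for closed events — no
SAW input) and that the crux is equivalent to its CORE "μ-a.e. simple ∧ range ∩ ∂D ⊆ {a, b}"
(`simpleSubseqLimits_iff_core`), whose two clauses are pinned to `x = x_c` from opposite sides
(supercritical limits are onto the domain, `SimpleSubseqLimitsCriticality`; subcritical limits in
non-convex domains crawl on `∂D`, Disproof remark gen 3). This skeleton therefore cuts the crux along its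
two genuine clauses, and cuts EACH clause once more into one quantitative LATTICE ESTIMATE, uniform in the
mesh, and a soft PASSAGE to the limit through CLOSED events (the closed-set portmanteau transfer of the twin's
`Negative/SimpleSubseqLimitsCore`, the lesson of the twin chain's drefute remarks R1/R2: exact configurations
do not pass to weak limits, thickened events do). For simplicity the lattice estimate is the UNIFORM
INJECTIVITY MODULUS — the `ℤ²` transcription of the estimate that the hexagonal chains isolated as THE
missing input (`Cruxes/HexConjecture/Lines/root_locality_replaces_loewner.lean: stub_uniformModulus`,
`Theorems/SAWDevelopingMapObservableToSLEChordalCarrierReduction.lean: ae_mem_simple_of_uniformModulus`,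
and its necessity `Theorems/ObservableToSLE/Negative/ModulusNecessity.lean`).

## The cut (four stubs; the free clauses are discharged in the assembly by the landed theorem)

* S1 `stub_noQuasiLoops` — UNIFORM INJECTIVITY MODULUS OF THE CRITICAL `ℤ²` SAW (the load-bearing estimate
  for simplicity; XL): for every `(D, a, b)` and `ε, η > 0` there is `θ > 0` with, for all small `δ > 0`,
  `P_δ[γ.curve ∉ CurveClass.modulusClass ε θ] ≤ η` — i.e. with probability `≥ 1 − η` no `ε`-excursion of
  the rescaled walk closes up to Euclidean distance `θ` (no macroscopic quasi-loop / near-self-touching;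
  Aizenman–Burchard's injectivity modulus, tree file `Literature/…/SimpleCurves.lean`; LSW04 §3.4.5 made
  quantitative). `modulusClass` is closed and every representative of a class in it has the modulus
  (`CurveClass.mk_mem_modulusClass_iff`), so the event is read off the polyline itself.
* S2 `stub_simpleOfNoQuasiLoops` — PASSAGE (soft; M in Lean): at a fixed `(D, a, b)`, the S1 bound forces
  every weak subsequential limit along `s n → 0⁺` to be `μ`-a.e. SIMPLE. Proof to adapt verbatim from the
  hexagonal precedent `ObservableToSLE.FloorRatio.ae_mem_simple_of_uniformModulus`:
  `simple = {source ≠ target} ∩ ⋂ₙ ⋃ₘ modulusClass (1/(n+1)) (1/(m+1))` (`CurveClass.simple_eq_iInter`),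
  closed-set transfer `μ(modulusClass εₙ θ) ≥ limsup_k P_{s k}(…) ≥ 1 − η` (`isClosed_modulusClass`,
  `FiniteMeasure.limsup_measure_closed_le_of_tendsto` as in the twin's `ae_mem_of_isClosed_of_weakLimitAlong`),
  `modulusClass_mono` in `θ`, and `source = a ≠ b = target` a.e. (free clause + `MarkedDomain.pt_injective`).
* S3 `stub_noBoundaryApproach` — NO BOUNDARY APPROACH AWAY FROM THE MARKED POINTS, UNIFORMLY IN THE MESH (the
  load-bearing estimate for boundary avoidance; L–XL): for every `(D, a, b)` and `r, η > 0` there is `ρ > 0`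
  with, for all small `δ > 0`, `P_δ[some point of the polyline is ρ-close to ∂D and r-far from a and b] ≤ η`
  (entropic repulsion of the `x_c`-SAW from `∂D`; continuum shadow: SLE_{8/3} touches `∂D` only at its
  endpoints, one-point boundary exponent `2`). Stated on `γ.curve.range` (class-level).
* S4 `stub_boundaryAvoidingOfNoApproach` — PASSAGE (soft; M in Lean): at a fixed `(D, a, b)`, the S3 bound
  forces `μ`-a.e. `range ∩ frontier D ⊆ {D.pt 0, D.pt 1}`. Proof: the complement event
  `F(ρ, r) = {∀ z ∈ range, ρ ≤ infDist z ∂D ∨ dist z a ≤ r ∨ dist z b ≤ r}` is closed (`range` is upper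
  semicontinuous, `Curve.infDist_range_le`), closed-set transfer gives `μ(F(ρ, r)) ≥ 1 − η`, `F` is
  antitone in `ρ`, so `μ(⋃_ρ F(ρ, r)) = 1` for each rational `r`, and `⋂_r ⋃_ρ F(ρ, r)` is contained in
  `{range ∩ frontier D ⊆ {a, b}}` (a frontier point has `infDist · (frontier D) = 0`).

`SubseqSimple_of` (kernel-checked, no `sorry` of its own): S2 fed by S1 gives a.e. simplicity, S4 fed by S3
gives a.e. boundary avoidance, the LANDED `ae_source_target_range_of_weakLimitAlong` (twin Negative/Core,
p74405) gives the free clauses, and `closure D = D ∪ frontier D` (`closure_eq_self_union_frontier`) turns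
`range ⊆ closure D ∧ range ∩ frontier D ⊆ {a, b}` into `range ⊆ D ∪ {a, b}`; conclusion = the route decl BY
NAME (its inlined `let carrier` is ζ-reduced by `intro`, the membership closes definitionally).

Track B for the boundary half INSIDE THIS ROUTE (recorded, deliberately not registered): `SAWAvoidanceLaw`
(item stmt-11195, reached from the rank-2/3 cruxes by the proved `VitaliTransport`) with the proved
`AvoidanceOfLimit` gives every subsequential limit the SLE_{8/3} masses `Φ'_A(0)^{5/8}` of the closed hull
events `{range ⊆ cl D'}`; thin collar hulls along each `frontierPiece D k` have `Φ'_A(0) → 1`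
(`EllipseHulls.lean`, `CollarDomain.lean`), so the hexagonal pattern
`FloorRatio.ae_disjoint_frontierPiece_of_collars` yields S4's conclusion from A0 with no new lattice
estimate. It is not a stub here because it would make the closing of this item wait for A0 (i.e. for the
rank-2/3 cruxes) and would not serve the twin items of the other routes; S3 is the unconditional input.

Every stub is a CONSEQUENCE of the summit conjunct on paper — S1 by the `ℤ²` analogue of
`ModulusNecessity.uniformModulus_of_convergesInLawToSLE` (stability of moduli in the reparametrisation
distance, Urysohn function, portmanteau along `𝓝[>] 0`, Rohde–Schramm simplicity for κ = 8/3 ≤ 4), S3 by the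
same scheme against the boundary-avoiding SLE_{8/3} law (refuter evidence `subseqSimple_of_sawScalingLimit`
on this item: SLE_{8/3} laws are carried by `chordalCarrier`), S2/S4 unconditionally — so no stub is
`stub-false` unless LSW Prediction 1 as typed is. Disproof used: no `Disproof.lean` exists for THIS item
(`ledger crux ls stmt-CriticalPhenomena-11194`: no workfiles before this one, 2026-08-17); the twin's landed
negatives are honoured — every stub keeps ALL hypotheses of the crux verbatim (`IsEndpointApprox` with both
endpoint limits: `simpleSubseqLimits_false_without_tendsto_fst/snd`; one-sided mesh limit and the weak-limit
hypothesis: `crux_false_without_meshLimit`, `crux_false_with_twoSidedMeshLimit`,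
`crux_false_without_weakLimit`; `IsProbabilityMeasure μ` kept; CRITICAL laws only:
`SimpleSubseqLimitsCriticality`), and S2 does not take the closed-set road for `simple` itself
(`simple_not_isClosed`, `exists_weakLimit_not_ae_simple`): it goes through the closed MODULUS events plus
the free endpoint clause (the constant class, `mk_const_not_mem_simple`, has every modulus but
`source = target`). ORDER/SHAPE split of the twin's PICKED line `marked-point-revisit` (Disproof §7 `diam`/`zig`,
§15 kiss): a failing injectivity modulus is witnessed by retraces AND kisses alike, so S1 needs no SHAPE
companion.
-/

noncomputable section

open MeasureTheory Filter Topology Set Metric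
open Literature.Probability.RandomPlanarGeometry Literature.Probability.LatticeModels
open scoped ENNReal NNReal BoundedContinuousFunction

namespace Summit.CriticalPhenomena.SAWScalingLimit.Cruxes.SubseqSimple.Birth

/-! ### Vocabulary of the line (for reading; the stubs below inline everything in tree vocabulary) -/

/-- The OPEN boundary-approach event `B_D(ρ, r)`: some point of the trace is `ρ`-close to `∂D` and
`r`-far from both marked points. -/
def boundaryApproach (D : DobrushinDomain) (ρ r : ℝ) : Set (CurveClass ℂ) :=
  {c | ∃ z ∈ c.range, Metric.infDist z (frontier D.carrier) < ρ ∧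
    r < dist z (D.pt 0) ∧ r < dist z (D.pt 1)}

/-- The weak-limit hypothesis of the crux at `(D, a, b)` along `s` (verbatim the crux's clause; it is
definitionally the twin's `SimpleSubseqLimits.Negative.WeakLimitAlong D a b s μ`). -/
def IsWeakLimit (D : DobrushinDomain) (a b : ℝ → Site 2) (s : ℕ → ℝ) (μ : Measure (CurveClass ℂ)) :
    Prop :=
  ∀ f : CurveClass ℂ →ᵇ ℝ,
    Tendsto (fun n => ∫ γ, f γ.curve ∂(SAW.law D.carrier (s n) (a (s n)) (b (s n)))) atTop
      (𝓝 (∫ x, f x ∂μ))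

/-- The uniform injectivity modulus of the critical SAW at `(D, a, b)` (S1 at one endpoint approximation). -/
def UniformModulusAt (D : DobrushinDomain) (a b : ℝ → Site 2) : Prop :=
  ∀ ε η : ℝ, 0 < ε → 0 < η → ∃ θ : ℝ, 0 < θ ∧
    ∀ᶠ δ : ℝ in 𝓝[>] 0,
      SAW.law D.carrier δ (a δ) (b δ) {γ | γ.curve ∉ CurveClass.modulusClass ε θ} ≤
        ENNReal.ofReal η

/-- The uniform no-boundary-approach bound of the critical SAW at `(D, a, b)` (S3 at one endpoint
approximation). -/
def NoBoundaryApproachAt (D : DobrushinDomain) (a b : ℝ → Site 2) : Prop :=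
  ∀ r η : ℝ, 0 < r → 0 < η → ∃ ρ : ℝ, 0 < ρ ∧
    ∀ᶠ δ : ℝ in 𝓝[>] 0,
      SAW.law D.carrier δ (a δ) (b δ) {γ | γ.curve ∈ boundaryApproach D ρ r} ≤ ENNReal.ofReal η

/-- **S1, named.** Uniform injectivity modulus (no macroscopic quasi-loops) of the critical `ℤ²` SAW. -/
def NoQuasiLoops : Prop :=
  ∀ (D : DobrushinDomain) (a b : ℝ → Site 2), SAW.IsEndpointApprox D a b → UniformModulusAt D a b

/-- **S2, named.** Passage: uniform injectivity modulus ⇒ subsequential limits are a.s. simple. -/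
def SimpleOfNoQuasiLoops : Prop :=
  ∀ (D : DobrushinDomain) (a b : ℝ → Site 2), SAW.IsEndpointApprox D a b → UniformModulusAt D a b →
    ∀ (s : ℕ → ℝ) (μ : Measure (CurveClass ℂ)), Tendsto s atTop (𝓝[>] (0 : ℝ)) →
      IsProbabilityMeasure μ → IsWeakLimit D a b s μ → ∀ᵐ γ ∂μ, γ ∈ CurveClass.simple

/-- **S3, named.** Uniform absence of boundary approaches away from the marked points. -/
def NoBoundaryApproach : Prop :=
  ∀ (D : DobrushinDomain) (a b : ℝ → Site 2), SAW.IsEndpointApprox D a b → NoBoundaryApproachAt D a b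

/-- **S4, named.** Passage: no boundary approach ⇒ subsequential limits a.s. meet `∂D` only at `a, b`. -/
def BoundaryAvoidingOfNoApproach : Prop :=
  ∀ (D : DobrushinDomain) (a b : ℝ → Site 2), SAW.IsEndpointApprox D a b → NoBoundaryApproachAt D a b →
    ∀ (s : ℕ → ℝ) (μ : Measure (CurveClass ℂ)), Tendsto s atTop (𝓝[>] (0 : ℝ)) →
      IsProbabilityMeasure μ → IsWeakLimit D a b s μ →
        ∀ᵐ γ ∂μ, γ.range ∩ frontier D.carrier ⊆ {D.pt 0, D.pt 1}

/-! ### The stubs (the ONLY `sorry`s of this file)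

Each stub is stated over TREE VOCABULARY ONLY (the named statements above unfolded by hand), so that it lands
verbatim as a `Theorems/SAWChargeContinuationSubseqSimple<Stub>.lean --supports stmt-CriticalPhenomena-11194`
without importing this workfile (imports needed there: the route file or `SelfAvoidingWalk`, and
`Literature.Probability.RandomPlanarGeometry.SimpleCurves` for `CurveClass.modulusClass`); the `*_holds`
theorems below certify definitionally (`:= stub_…`) that the unfolded text IS the named statement. -/

/-- **S1 — uniform injectivity modulus of the critical `ℤ²` SAW (no macroscopic quasi-loops).** For the
critical SAW in `(D_δ; a_δ, b_δ)` and every `ε, η > 0` there is `θ > 0` such that for all small `δ > 0`,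
with probability `≥ 1 − η` the curve class of the walk lies in `CurveClass.modulusClass ε θ`: whenever two
points `γ s`, `γ t` (`s ≤ t`) of the rescaled polyline are `θ`-close, the arc between them stays within
`ε` of `γ s`. The genuine "no macroscopic near-self-touching" estimate for the `x_c`-SAW under EVERY
endpoint approximation (LSW04 §3.4.5 heuristic; hairpin cut-and-reconnect / Kesten-pattern surgery in the
`x_c`-ensemble, where length is not conserved; only sub-ballisticity, Duminil-Copin–Hammond 2013, is in
print). `ℤ²` transcription of the hexagonal `stub_uniformModulus`; summit-implied on paper
(`ModulusNecessity.uniformModulus_of_convergesInLawToSLE`, transposed). -/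
theorem stub_noQuasiLoops :
    ∀ (D : DobrushinDomain) (a b : ℝ → Site 2), SAW.IsEndpointApprox D a b →
      ∀ ε η : ℝ, 0 < ε → 0 < η → ∃ θ : ℝ, 0 < θ ∧
        ∀ᶠ δ : ℝ in 𝓝[>] 0,
          SAW.law D.carrier δ (a δ) (b δ) {γ | γ.curve ∉ CurveClass.modulusClass ε θ} ≤
            ENNReal.ofReal η := by
  sorry

/-- **S2 — passage: uniform injectivity modulus ⇒ a.s. simple subsequential limits.** At a fixed
Dobrushin domain and endpoint approximation, the bound of S1 forces every weak subsequential limit `μ`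
of the SAW laws along `s n → 0⁺` to be carried by `CurveClass.simple`. Soft (adapt
`ObservableToSLE.FloorRatio.ae_mem_simple_of_uniformModulus` from `hexSAWLaw`/`IsSubseqLimitLaw` to
`SAW.law` along a sequence): `CurveClass.simple_eq_iInter`, `isClosed_modulusClass` + the closed-set
transfer of `SimpleSubseqLimits.Negative.ae_mem_of_isClosed_of_weakLimitAlong` (quantitative form),
`modulusClass_mono`, and `source = a ≠ b = target` a.e. (`ae_source_target_range_of_weakLimitAlong`,
`MarkedDomain.pt_injective`). -/
theorem stub_simpleOfNoQuasiLoops :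
    ∀ (D : DobrushinDomain) (a b : ℝ → Site 2), SAW.IsEndpointApprox D a b →
      (∀ ε η : ℝ, 0 < ε → 0 < η → ∃ θ : ℝ, 0 < θ ∧
        ∀ᶠ δ : ℝ in 𝓝[>] 0,
          SAW.law D.carrier δ (a δ) (b δ) {γ | γ.curve ∉ CurveClass.modulusClass ε θ} ≤
            ENNReal.ofReal η) →
      ∀ (s : ℕ → ℝ) (μ : Measure (CurveClass ℂ)), Tendsto s atTop (𝓝[>] (0 : ℝ)) →
        IsProbabilityMeasure μ →
        (∀ f : CurveClass ℂ →ᵇ ℝ,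
          Tendsto (fun n => ∫ γ, f γ.curve ∂(SAW.law D.carrier (s n) (a (s n)) (b (s n)))) atTop
            (𝓝 (∫ x, f x ∂μ))) →
        ∀ᵐ γ ∂μ, γ ∈ CurveClass.simple := by
  sorry

/-- **S3 — no boundary approach away from the marked points, uniformly in the mesh.** For the critical
SAW in `(D_δ; a_δ, b_δ)` and every `r, η > 0` there is `ρ > 0` such that for all small `δ > 0` the
probability that the polyline comes `ρ`-close to `∂D` at a point `r`-far from both `a` and `b` is `≤ η`
(no boundary crawling: entropic repulsion of the `x_c`-SAW from `∂D`, bridge / boundary-approach bounds;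
continuum shadow: SLE_{8/3} meets `∂D` only at its endpoints). Summit-implied on paper (closed
enlargements, portmanteau against the boundary-avoiding SLE_{8/3} law). The twin Disproof §14 warns that
the simply-connected geometry of `Ω_δ` is load-bearing (ring-road counterexample for island pasts); inside
this route the same conclusion also follows from `SAWAvoidanceLaw` by collar hulls (Track B of the header). -/
theorem stub_noBoundaryApproach :
    ∀ (D : DobrushinDomain) (a b : ℝ → Site 2), SAW.IsEndpointApprox D a b →
      ∀ r η : ℝ, 0 < r → 0 < η → ∃ ρ : ℝ, 0 < ρ ∧
        ∀ᶠ δ : ℝ in 𝓝[>] 0,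
          SAW.law D.carrier δ (a δ) (b δ)
              {γ | ∃ z ∈ γ.curve.range, Metric.infDist z (frontier D.carrier) < ρ ∧
                r < dist z (D.pt 0) ∧ r < dist z (D.pt 1)} ≤
            ENNReal.ofReal η := by
  sorry

/-- **S4 — passage: no boundary approach ⇒ a.s. boundary-avoiding subsequential limits.** At a fixed
Dobrushin domain and endpoint approximation, the bound of S3 forces every weak subsequential limit `μ`
along `s n → 0⁺` to satisfy `range ∩ frontier D ⊆ {a, b}` a.s. Soft: the complement event
`{∀ z ∈ range, ρ ≤ infDist z ∂D ∨ dist z a ≤ r ∨ dist z b ≤ r}` is closed (`Curve.infDist_range_le`),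
closed-set transfer, antitonicity in `ρ`, intersection over rational `r`. -/
theorem stub_boundaryAvoidingOfNoApproach :
    ∀ (D : DobrushinDomain) (a b : ℝ → Site 2), SAW.IsEndpointApprox D a b →
      (∀ r η : ℝ, 0 < r → 0 < η → ∃ ρ : ℝ, 0 < ρ ∧
        ∀ᶠ δ : ℝ in 𝓝[>] 0,
          SAW.law D.carrier δ (a δ) (b δ)
              {γ | ∃ z ∈ γ.curve.range, Metric.infDist z (frontier D.carrier) < ρ ∧
                r < dist z (D.pt 0) ∧ r < dist z (D.pt 1)} ≤
            ENNReal.ofReal η) →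
      ∀ (s : ℕ → ℝ) (μ : Measure (CurveClass ℂ)), Tendsto s atTop (𝓝[>] (0 : ℝ)) →
        IsProbabilityMeasure μ →
        (∀ f : CurveClass ℂ →ᵇ ℝ,
          Tendsto (fun n => ∫ γ, f γ.curve ∂(SAW.law D.carrier (s n) (a (s n)) (b (s n)))) atTop
            (𝓝 (∫ x, f x ∂μ))) →
        ∀ᵐ γ ∂μ, γ.range ∩ frontier D.carrier ⊆ {D.pt 0, D.pt 1} := by
  sorry

/-! ### Consistency: each named statement IS its registered stub (definitionally) -/

theorem noQuasiLoops_holds : NoQuasiLoops := stub_noQuasiLoops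
theorem simpleOfNoQuasiLoops_holds : SimpleOfNoQuasiLoops := stub_simpleOfNoQuasiLoops
theorem noBoundaryApproach_holds : NoBoundaryApproach := stub_noBoundaryApproach
theorem boundaryAvoidingOfNoApproach_holds : BoundaryAvoidingOfNoApproach :=
  stub_boundaryAvoidingOfNoApproach

/-! ### Name-keyed aliases of the four statements — the hypotheses of `SubseqSimple_of`

The native skeleton audit (`#h21_check_skeleton`) admits a hypothesis of the skeleton theorem only if its
head constant is a registered obligation or is NAMED like a declared stub; `__Registered.stub_X` is the
statement of `stub_X` under that name (device of `Cruxes/AxiomsOfLimit/Lines/birth.lean`; the `__`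
namespace is an implementation detail, so the audit's stub report resolves each `stub_…` to the sorried
theorem, not to the alias). Each alias is definitionally its statement. -/
namespace __Registered

/-- Alias of `NoQuasiLoops` keyed by the registered stub name. -/
abbrev stub_noQuasiLoops : Prop := NoQuasiLoops
/-- Alias of `SimpleOfNoQuasiLoops` keyed by the registered stub name. -/
abbrev stub_simpleOfNoQuasiLoops : Prop := SimpleOfNoQuasiLoops
/-- Alias of `NoBoundaryApproach` keyed by the registered stub name. -/
abbrev stub_noBoundaryApproach : Prop := NoBoundaryApproach
/-- Alias of `BoundaryAvoidingOfNoApproach` keyed by the registered stub name. -/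
abbrev stub_boundaryAvoidingOfNoApproach : Prop := BoundaryAvoidingOfNoApproach

end __Registered

/-! ### The skeleton theorem: the four stubs imply the crux, BY NAME -/

/-- **`SubseqSimple` from the line `birth`** (kernel-checked, no `sorry` of its own). Fix
`(D, a, b, s, μ)` as in the crux. S2 fed with S1 gives `μ`-a.e. simplicity; S4 fed with S3 gives
`μ`-a.e. `range ∩ ∂D ⊆ {a, b}`; the landed free-clauses theorem
`SimpleSubseqLimits.Negative.ae_source_target_range_of_weakLimitAlong` gives `μ`-a.e. `source = a`,
`target = b`, `range ⊆ closure D`; finally `closure D = D ∪ frontier D` converts the last two facts into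
`range ⊆ D ∪ {a, b}`. Hypotheses = the four stubs under their registered names; conclusion = the route
decl by name (its inlined `let carrier` is ζ-reduced by `intro`; the membership is closed definitionally). -/
theorem SubseqSimple_of (h₁ : __Registered.stub_noQuasiLoops)
    (h₂ : __Registered.stub_simpleOfNoQuasiLoops) (h₃ : __Registered.stub_noBoundaryApproach)
    (h₄ : __Registered.stub_boundaryAvoidingOfNoApproach) :
    Summit.CriticalPhenomena.SAWScalingLimit.Theses.SAWChargeContinuation.SubseqSimple := by
  intro D a b hab s μ hs hμ hlim
  have hsimple : ∀ᵐ γ ∂μ, γ ∈ CurveClass.simple :=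
    h₂ D a b hab (h₁ D a b hab) s μ hs hμ hlim
  have hbdry : ∀ᵐ γ ∂μ, γ.range ∩ frontier D.carrier ⊆ {D.pt 0, D.pt 1} :=
    h₄ D a b hab (h₃ D a b hab) s μ hs hμ hlim
  haveI : IsProbabilityMeasure μ := hμ
  have hfree : ∀ᵐ γ ∂μ, γ.source = D.pt 0 ∧ γ.target = D.pt 1 ∧ γ.range ⊆ closure D.carrier :=
    Summit.CriticalPhenomena.SAWScalingLimit.Theorems.SimpleSubseqLimits.Negative.ae_source_target_range_of_weakLimitAlong
      (ν := μ) hab hs hlim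
  filter_upwards [hsimple, hbdry, hfree] with γ hγ₁ hγ₂ hγ₃
  obtain ⟨hsrc, htgt, hcl⟩ := hγ₃
  have hrange : γ.range ⊆ D.carrier ∪ {D.pt 0, D.pt 1} := by
    intro z hz
    have hz' : z ∈ closure D.carrier := hcl hz
    rw [closure_eq_self_union_frontier] at hz'
    rcases hz' with h | h
    · exact Or.inl h
    · exact Or.inr (hγ₂ ⟨hz, h⟩)
  show γ ∈ CurveClass.simple ∩ {c | c.source = D.pt 0} ∩ {c | c.target = D.pt 1} ∩
      {c | c.range ⊆ D.carrier ∪ {D.pt 0, D.pt 1}}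
  exact ⟨⟨⟨hγ₁, hsrc⟩, htgt⟩, hrange⟩

/-- Wiring check (an `example`, so that `SubseqSimple_of` stays the only theorem concluding the crux): the
registered stubs, with their tree-vocabulary types, feed the skeleton theorem as stated — this term becomes
the crux proof when the four `sorry`s above are discharged. -/
example : Summit.CriticalPhenomena.SAWScalingLimit.Theses.SAWChargeContinuation.SubseqSimple :=
  SubseqSimple_of stub_noQuasiLoops stub_simpleOfNoQuasiLoops stub_noBoundaryApproach
    stub_boundaryAvoidingOfNoApproach

end Summit.CriticalPhenomena.SAWScalingLimit.Cruxes.SubseqSimple.Birth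

end
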